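import Summits.QuantumFields.BalabanUV.Beta.LagrangeFoldZero
import Summits.QuantumFields.BalabanUV.Beta.RelInvBorderedHessian
import Summits.QuantumFields.BalabanUV.Beta.RelInvFactorSandwich
import Summits.QuantumFields.BalabanUV.Beta.WardLocusSymSockets

/-!
# `BalabanUV.Beta.LagrangeFoldMixed` — binder row D1, the K PART of the ORDER-ONE CONSISTENCY (c1) for the (0.4) literal, step 1: **THE KKT
# MULTIPLIER-BLOCK IDENTITY FOR A MIXED SANDWICH BY FACTORISATION** `(A ∘ 𝕄_ff ∘ G)_mm = −A_mm` — straight resolvent `A` on the left, dressed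
# resolvent `G` on the right — from (R1) `(A∘𝕄)_mf = 0` and (R2) `(𝕄∘G)_mm = 1_coarse` ALONE (no relative-inverse chart, no `[E, X] = 0`), and its
# instances at the literal's resolvents: `colM (KInvStep Lc (j+1) ∘ E2 (j+1) ∘ Gsym Lc (j+1)) = −(wVH (j+1))⁻¹ · colM (Gsym Lc (j+1))` and the level-`0` twin
# (β sub-cell, BINDER-OWNERS row D1 OWNER `b2b-balaban-beta-an2`, gen 29; successor brick of [AN2-G29-LANDED-WARD])

HONEST FRAMING (cell charter, verbatim): «discharging BetaPertH makes Bałaban's UV stability UNCONDITIONAL — a real constructive-QFT result; it is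
NOT the continuum limit and NOT the Clay problem.»  HONEST DEPENDENCY: continuum YM on T⁴ ⇐ BetaPertH ∧ nine spine estimates (0/9 proved);
BetaPertH ⇐ (D1) ∧ (D4) ∧ CAP+tail; G-an2-4 gates asym, D1 and NE2/3/4.
NOT IN PRINT; OUR BOOKKEEPING.  [folklore] kernel algebra over tree objects BY NAME; no statement of Bałaban's papers, no `[cite:]`, no `def`, no
`def … : Prop`; instantiates NO binder of the β-function wall.  NOT D1, NOT `BetaPertH`, NOT continuum, NOT Clay.

WHY.  The slotted first-order tables `SrecOf V H G` type their Λ-sector through the STRAIGHT step resolvents (`lamCoeffK (KInvStep Lc (j+1)) (E2 (j+1))`,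
`lamCoeffOf (KInv Lc)`), while the one-step kernel reads the vertex through the DRESSED `G_j`.  For the comb (`G_j = Πᵀ∘A∘Π`, chart (I)) leaf-10's
`LagrangeFoldLiteral` closed the gap by BLINDNESS (`Π E2 = E2 = E2 Πᵀ`) + the chart-(I) identity `LagrangeFoldStep.mm_sandwich_eq_neg` (`RelInv G 𝕄 (axEc ρ N)`,
`comp_axEc_apply`).  For the symmetrised dressing (chart (II), `symEc` NOT bond-diagonal — R-D1-g28-2) the same conclusion follows from the FACTORISATION
identities already in the tree (E1 `RelInvFactorSandwich.comp_bhKStep_Gsym = piKSymBmC`, leaf-07's `RelInvBorderedHessianStep.comp_KInvStep_bhKStep`,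
`BorderedHessianResidual.comp_KInv_bhK`), with NO blindness and NO chart.

WHAT.
* §1 (generic `A 𝕄 G H`) **`mm_mixed_sandwich_eq_neg`**: `A`, `G` decaying, `𝕄` bounded with zero multiplier block, `H` = the field block of `𝕄`, (R1)
  `(A∘𝕄)(x,v)(inr m, inl l) = 0`, (R2) `(𝕄∘G)(u,z)(inr ν, inr m′) = [u = z][ν = m′]` on coarse rows `u`, and `A`'s multiplier columns coarse ⇒
  `(A∘H∘G)(x,z)(inr m, inr m′) = −A(x,z)(inr m, inr m′)` — the proof of `mm_sandwich_eq_neg` with step (c) replaced by (R1) and steps (e)–(g) by (R2).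
* §2 the literal's instances (generic `d`, centred root): `comp_KInvStep_bhKStep_inr_inl` ((R1) at `j+1`), `comp_KInvStep_bhKStep_zero_inr_inl` ((R1) at `0`),
  `KInvStep_inr_inr_of_col_off` (coarse multiplier columns), **`colM_mixed_sandwich_E2_sym`**:
  `colM (KInvStep Lc (j+1) ∘ E2 d Lc (j+1) ∘ Gsym Lc (j+1)) Lc μ y ρ′ w = −(wVH (j+1))⁻¹ · colM (Gsym Lc (j+1)) Lc μ y ρ′ w`, and **`colM_mixed_sandwich_zero_sym`**
  (level `0`, `H₀` = the field block of `bhK Lc`): `colM (KInvStep Lc 0 ∘ H₀ ∘ Gsym Lc 0) Lc μ y ρ′ w = −colM (Gsym Lc 0) Lc μ y ρ′ w`.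
Provenance: β sub-cell, unit beta-an2 gen 29, 2026-08-21 (v1); over leaf-10's `LagrangeFoldStep`∕`LagrangeFoldZero`, an2's E1, leaf-07's `RelInvBorderedHessianStep`,
`BorderedHessianResidual`, `WardLocusSymSockets` BY NAME; no existing file touched.
-/

noncomputable section

open Finset
open scoped BigOperators
open Literature.MathematicalPhysics.QuantumFieldTheory
open Literature.MathematicalPhysics.QuantumFieldTheory.Balaban1983to89
open Literature.MathematicalPhysics.QuantumFieldTheory.Balaban1983to89.Beta
open B12Sec2to5 (l1 l1_nonneg)
open ExpKernelCalculus (MKer Decays comp summable_exp_shift summable_exp_shift')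
open KernelWard (ProdBound tsum_comm_of_prodBound bdd_of_decays)
open AffineAveraging (box toSite)
open AveragingContoursRooted (ctr ctrOff ctrOff_mem_box)
open OneStepResolventKernel (Fib KInv decays_mono)
open OneStepKernelFamily (KInvStep KInvStep_inr_off decays_KInvStep colH vertexOfK)
open BalabanStepJetsSucc (E2 wVH decays_E2)
open SecondOrderResponse (colM vertexOfM)
open Literature.Probability.LatticeModels (Torus.proj)
open Summit.QuantumFields.BalabanUV.Beta.TameKernelCalculus
open Summit.QuantumFields.BalabanUV.Beta.AxialDressingRooted (one_le_of_neZero)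
open Summit.QuantumFields.BalabanUV.Beta.BorderedHessian (bhK bhK_inr_inr sgnK sgnK_apply bhKStep bhKStep_zero bhKStep_succ_inl_inl bhKStep_succ_inr_inr
  spr_bhKStep resid resid_inl_inr comp_KInv_bhK comp_bhKStep_KInvStep_inl_inr comp_KInvStep_bhKStep KInvStep_zero_eq)
open Summit.QuantumFields.BalabanUV.Beta.BubbleParity (trK_KInvStep)
open Summit.QuantumFields.BalabanUV.Beta.LagrangeFold (comp_inr_col_eq_zero E2_inr_col)
open Summit.QuantumFields.BalabanUV.Beta.LagrangeFoldStep (summable_row_mul summable_mul_col GH_mf GM_mf_split MG_mm wVH_ne_zero)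
open Summit.QuantumFields.BalabanUV.Beta.SymmetrisedStepJets (Gsym Gsym_apply decays_Gsym)
open Summit.QuantumFields.BalabanUV.Beta.RelInvFactorSandwich (comp_bhKStep_Gsym_inr_inr)
open Summit.QuantumFields.BalabanUV.Beta.WardLocusSymSockets (colM_Gsym)

namespace Summit.QuantumFields.BalabanUV.Beta.LagrangeFoldMixed

variable {d : ℕ} {N : ℕ}

/-! ## §1 The KKT multiplier-block identity for a mixed sandwich, by factorisation -/

section Generic

variable {A M G H : MKer (d + 1) (Fib d)}

/-- [folklore] Step (g′): if `A`'s multiplier columns are coarse and `(𝕄∘G)_mm` is the identity between coarse multiplier legs, then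
`Σ'_u Σ_ν A(x,u)(inr m, inr ν)·(𝕄∘G)(u,z)(inr ν, inr m′) = A(x,z)(inr m, inr m′)`. -/
theorem sum_A_mm_MG_mm
    (hMG : ∀ (u z : Fin (d + 1) → ℤ) (ν m' : Fin (d + 1)), Torus.proj N u = 0 →
      comp M G u z (Sum.inr ν) (Sum.inr m') = if u = z ∧ ν = m' then 1 else 0)
    (hAcol : ∀ (x u : Fin (d + 1) → ℤ) (m ν : Fin (d + 1)), Torus.proj N u ≠ 0 → A x u (Sum.inr m) (Sum.inr ν) = 0)
    (x z : Fin (d + 1) → ℤ) (m m' : Fin (d + 1)) :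
    ∑' u, ∑ ν : Fin (d + 1), A x u (Sum.inr m) (Sum.inr ν) * comp M G u z (Sum.inr ν) (Sum.inr m') = A x z (Sum.inr m) (Sum.inr m') := by
  have e : ∀ u ν, A x u (Sum.inr m) (Sum.inr ν) * comp M G u z (Sum.inr ν) (Sum.inr m')
      = A x u (Sum.inr m) (Sum.inr ν) * (if u = z ∧ ν = m' then 1 else 0) := by
    intro u ν
    by_cases hp : Torus.proj N u = 0
    · rw [hMG u z ν m' hp]
    · rw [hAcol x u m ν hp, zero_mul, zero_mul]
  simp only [e]
  rw [tsum_eq_single z (fun u hu => Finset.sum_eq_zero fun ν _ => by simp only [hu, false_and, if_false, mul_zero])]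
  rw [Finset.sum_eq_single m' (fun ν _ hν => by simp only [hν, and_false, if_false, mul_zero])
    (fun h => absurd (Finset.mem_univ m') h)]
  simp only [and_self, if_true, mul_one]

/-- [folklore] **THE KKT MULTIPLIER-BLOCK IDENTITY FOR A MIXED SANDWICH, BY FACTORISATION.**  For decaying `A`, `G`, a bounded `𝕄` with ZERO
multiplier block, `H` = the field block of `𝕄` (all other blocks zero), (R1) `(A∘𝕄)(x,v)(inr m, inl l) = 0` (the straight residual has no
multiplier–field block), (R2) `(𝕄∘G)(u,z)(inr ν, inr m′) = [u = z][ν = m′]` for coarse `u`, and `A`'s multiplier columns coarse: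
`(A∘H∘G)(x,z)(inr m, inr m′) = −A(x,z)(inr m, inr m′)`. -/
theorem mm_mixed_sandwich_eq_neg (hA : ∃ δ C : ℝ, 0 < δ ∧ 0 ≤ C ∧ Decays A C δ) (hG : ∃ δ C : ℝ, 0 < δ ∧ 0 ≤ C ∧ Decays G C δ)
    (hM : ∃ B : ℝ, ∀ x z a b, |M x z a b| ≤ B) (hMmm : ∀ x z ν ν', M x z (Sum.inr ν) (Sum.inr ν') = 0)
    (hHff : ∀ x z κ l, H x z (Sum.inl κ) (Sum.inl l) = M x z (Sum.inl κ) (Sum.inl l))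
    (hHfm : ∀ x z κ ν, H x z (Sum.inl κ) (Sum.inr ν) = 0) (hHmf : ∀ x z ν l, H x z (Sum.inr ν) (Sum.inl l) = 0)
    (hHmm : ∀ x z ν ν', H x z (Sum.inr ν) (Sum.inr ν') = 0)
    (hAM : ∀ (x v : Fin (d + 1) → ℤ) (m l : Fin (d + 1)), comp A M x v (Sum.inr m) (Sum.inl l) = 0)
    (hMG : ∀ (u z : Fin (d + 1) → ℤ) (ν m' : Fin (d + 1)), Torus.proj N u = 0 →
      comp M G u z (Sum.inr ν) (Sum.inr m') = if u = z ∧ ν = m' then 1 else 0)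
    (hAcol : ∀ (x u : Fin (d + 1) → ℤ) (m ν : Fin (d + 1)), Torus.proj N u ≠ 0 → A x u (Sum.inr m) (Sum.inr ν) = 0)
    (x z : Fin (d + 1) → ℤ) (m m' : Fin (d + 1)) :
    comp (comp A H) G x z (Sum.inr m) (Sum.inr m') = -A x z (Sum.inr m) (Sum.inr m') := by
  obtain ⟨δA, CA, hδA, hCA, hAd⟩ := hA
  obtain ⟨δG, CG, hδG, hCG, hGd⟩ := hG
  obtain ⟨B, hB⟩ := hM
  have hHcol : ∀ v u (h : Fib d) (ν : Fin (d + 1)), H v u h (Sum.inr ν) = 0 := fun v u h ν => by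
    cases h with
    | inl κ => exact hHfm v u κ ν
    | inr ν' => exact hHmm v u ν' ν
  -- the remainder R(v, l) := Σ'_u Σ_ν A(x,u)(inr m, inr ν)·𝕄(u,v)(inr ν, inl l)
  set R : (Fin (d + 1) → ℤ) → Fin (d + 1) → ℝ :=
    fun v l => ∑' u, ∑ ν : Fin (d + 1), A x u (Sum.inr m) (Sum.inr ν) * M u v (Sum.inr ν) (Sum.inl l) with hR
  -- (AH)_mf · G_fm = −R · G_fm, by (R1)
  have hAH : ∀ v l, comp A H x v (Sum.inr m) (Sum.inl l) * G v z (Sum.inl l) (Sum.inr m') = -(R v l * G v z (Sum.inl l) (Sum.inr m')) := by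
    intro v l
    have h1 : comp A H x v (Sum.inr m) (Sum.inl l) = comp A M x v (Sum.inr m) (Sum.inl l) - R v l := by
      rw [GH_mf hHff hHmf, GM_mf_split ⟨δA, CA, hδA, hCA, hAd⟩ ⟨B, hB⟩, hR]
      ring
    rw [h1, sub_mul, hAM, zero_mul, zero_sub]
  -- bounds
  have hBabs : ∀ x z a b, |M x z a b| ≤ |B| := fun x z a b => (hB x z a b).trans (le_abs_self B)
  -- the double family F(u, v) := Σ_ν Σ_l A(x,u)(m,ν) 𝕄(u,v)(ν,l) G(v,z)(l,m')
  set F : (Fin (d + 1) → ℤ) → (Fin (d + 1) → ℤ) → ℝ := fun u v =>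
    ∑ ν : Fin (d + 1), ∑ l : Fin (d + 1), A x u (Sum.inr m) (Sum.inr ν) * M u v (Sum.inr ν) (Sum.inl l) * G v z (Sum.inl l) (Sum.inr m')
    with hF
  have hPB : ProdBound F := by
    refine ⟨fun u => ((d + 1 : ℕ) * ((d + 1 : ℕ) * (CA * |B| * CG))) * Real.exp (-δA * l1 (x - u)),
      fun v => Real.exp (-δG * l1 (v - z)), (summable_exp_shift hδA x).mul_left _, summable_exp_shift' hδG z,
      fun u => by positivity, fun v => (Real.exp_pos _).le, fun u v => ?_⟩
    calc |F u v| ≤ ∑ ν : Fin (d + 1), |∑ l : Fin (d + 1), A x u (Sum.inr m) (Sum.inr ν) * M u v (Sum.inr ν) (Sum.inl l)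
            * G v z (Sum.inl l) (Sum.inr m')| := Finset.abs_sum_le_sum_abs _ _
      _ ≤ ∑ _ν : Fin (d + 1), ∑ _l : Fin (d + 1), (CA * Real.exp (-δA * l1 (x - u))) * |B| * (CG * Real.exp (-δG * l1 (v - z))) := by
          refine Finset.sum_le_sum fun ν _ => (Finset.abs_sum_le_sum_abs _ _).trans (Finset.sum_le_sum fun l _ => ?_)
          rw [abs_mul, abs_mul]
          exact mul_le_mul (mul_le_mul (hAd x u _ _) (hBabs u v _ _) (abs_nonneg _)
              ((abs_nonneg _).trans (hAd x u (Sum.inr m) (Sum.inr ν))))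
            (hGd v z _ _) (abs_nonneg _) (by positivity)
      _ = _ := by simp only [Finset.sum_const, Finset.card_univ, Fintype.card_fin, nsmul_eq_mul]; ring
  -- summability of the pieces
  have hsR : ∀ v l, Summable fun u => ∑ ν : Fin (d + 1), A x u (Sum.inr m) (Sum.inr ν) * M u v (Sum.inr ν) (Sum.inl l) :=
    fun v l => summable_sum fun ν _ => summable_row_mul hAd hδA x _ _ (fun u => hB u v _ _)
  have hsMG : ∀ u ν, Summable fun v => ∑ l : Fin (d + 1), M u v (Sum.inr ν) (Sum.inl l) * G v z (Sum.inl l) (Sum.inr m') :=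
    fun u ν => summable_sum fun l _ => summable_mul_col hGd hδG z _ _ (fun v => hB u v _ _)
  -- main computation
  rw [show comp (comp A H) G x z (Sum.inr m) (Sum.inr m') = ∑' v, ∑ g : Fib d, comp A H x v (Sum.inr m) g * G v z g (Sum.inr m') from rfl]
  have e1 : ∀ v, ∑ g : Fib d, comp A H x v (Sum.inr m) g * G v z g (Sum.inr m') = -∑' u, F u v := by
    intro v
    rw [Fintype.sum_sum_type]
    simp only [comp_inr_col_eq_zero hHcol, zero_mul, Finset.sum_const_zero, add_zero, hAH, Finset.sum_neg_distrib]
    refine congrArg Neg.neg ?_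
    have e2 : ∀ l, R v l * G v z (Sum.inl l) (Sum.inr m')
        = ∑' u, ∑ ν : Fin (d + 1), A x u (Sum.inr m) (Sum.inr ν) * M u v (Sum.inr ν) (Sum.inl l) * G v z (Sum.inl l) (Sum.inr m') := by
      intro l
      rw [hR, ← tsum_mul_right]
      exact tsum_congr fun u => Finset.sum_mul _ _ _
    simp only [e2]
    rw [← Summable.tsum_finsetSum (fun l _ => (hsR v l).mul_right _ |>.congr (fun u => Finset.sum_mul _ _ _))]
    exact tsum_congr fun u => Finset.sum_comm
  simp only [e1, tsum_neg]
  rw [← tsum_comm_of_prodBound hPB]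
  have e3 : ∀ u, ∑' v, F u v = ∑ ν : Fin (d + 1), A x u (Sum.inr m) (Sum.inr ν) * comp M G u z (Sum.inr ν) (Sum.inr m') := by
    intro u
    have e4 : ∀ v, F u v = ∑ ν : Fin (d + 1), A x u (Sum.inr m) (Sum.inr ν) *
        ∑ l : Fin (d + 1), M u v (Sum.inr ν) (Sum.inl l) * G v z (Sum.inl l) (Sum.inr m') := by
      intro v
      simp only [hF, Finset.mul_sum]
      exact Finset.sum_congr rfl fun ν _ => Finset.sum_congr rfl fun l _ => by ring
    simp only [e4]
    rw [Summable.tsum_finsetSum (fun ν _ => (hsMG u ν).mul_left _)]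
    refine Finset.sum_congr rfl fun ν _ => ?_
    rw [tsum_mul_left, MG_mm hMmm]
  simp only [e3]
  rw [sum_A_mm_MG_mm hMG hAcol]

end Generic

/-! ## §2 The literal's instances: straight step resolvent on the left, symmetrised dressed resolvent on the right -/

section Literal

variable {Lc : ℕ} [NeZero Lc]

/-- [folklore] **(R1) AT LEVEL `j+1`**: the straight left residual has no multiplier–field block —
`(KInvStep Lc (j+1) ∘ bhKStep d Lc (j+1))(x,v)(inr m, inl l) = 0` (`comp_KInvStep_bhKStep` = the transpose of the right residual, whose field–multiplier
block vanishes: `StepResidualFM.comp_bhKStep_KInvStep_inl_inr`). -/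
theorem comp_KInvStep_bhKStep_inr_inl (j : ℕ) (x v : Fin (d + 1) → ℤ) (m l : Fin (d + 1)) :
    comp (KInvStep (d := d) Lc (j + 1)) (bhKStep d Lc (j + 1)) x v (Sum.inr m) (Sum.inl l) = 0 := by
  rw [comp_KInvStep_bhKStep, trK_apply, comp_bhKStep_KInvStep_inl_inr]

/-- [folklore] **(R1) AT LEVEL `0`**: `(KInvStep Lc 0 ∘ bhKStep d Lc 0)(x,v)(inr m, inl l) = 0` (`KInvStep_zero_eq`, `bhKStep_zero`,
`BorderedHessianResidual.comp_KInv_bhK = trK resid`, `resid_inl_inr`). -/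
theorem comp_KInvStep_bhKStep_zero_inr_inl (x v : Fin (d + 1) → ℤ) (m l : Fin (d + 1)) :
    comp (KInvStep (d := d) Lc 0) (bhKStep d Lc 0) x v (Sum.inr m) (Sum.inl l) = 0 := by
  rw [KInvStep_zero_eq, bhKStep_zero, comp_KInv_bhK, trK_apply, resid_inl_inr]

/-- [folklore] **THE STRAIGHT STEP RESOLVENT HAS COARSE MULTIPLIER COLUMNS** (`trK_KInvStep`, `sgnK_apply`, `KInvStep_inr_off`). -/
theorem KInvStep_inr_inr_of_col_off (j : ℕ) (x u : Fin (d + 1) → ℤ) (m ν : Fin (d + 1)) (hu : Torus.proj Lc u ≠ 0) :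
    KInvStep (d := d) Lc j x u (Sum.inr m) (Sum.inr ν) = 0 := by
  have h := congrFun (congrFun (congrFun (congrFun (trK_KInvStep (d := d) Lc j) u) x) (Sum.inr ν)) (Sum.inr m)
  rw [trK_apply, sgnK_apply, KInvStep_inr_off j hu ν (Sum.inr m) x, mul_zero] at h
  exact h

/-- [folklore] **THE MULTIPLIER COLUMN OF THE MIXED SANDWICH AT THE LITERAL's RESOLVENTS, LEVEL `j+1`**:
`colM (KInvStep Lc (j+1) ∘ E2 d Lc (j+1) ∘ Gsym Lc (j+1)) Lc μ y ρ′ w = −(wVH (j+1))⁻¹ · colM (Gsym Lc (j+1)) Lc μ y ρ′ w`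
(§1 at `(A, 𝕄, G, H) := (KInvStep (j+1), bhKStep (j+1), Gsym (j+1), wVH (j+1) • E2 (j+1))`; the right-hand side through `colM_Gsym`). -/
theorem colM_mixed_sandwich_E2_sym (j : ℕ) (μ : Fin (d + 1)) (y : Fin (d + 1) → ℤ) (ρ' : Fin (d + 1)) (w : Fin (d + 1) → ℤ) :
    colM (comp (comp (KInvStep (d := d) Lc (j + 1)) (E2 d Lc (j + 1))) (Gsym (d := d) Lc (j + 1))) Lc μ y ρ' w
      = -(wVH d Lc (j + 1))⁻¹ * colM (Gsym (d := d) Lc (j + 1)) Lc μ y ρ' w := by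
  set A := KInvStep (d := d) Lc (j + 1) with hAdef
  set G := Gsym (d := d) Lc (j + 1) with hGdef
  set H : MKer (d + 1) (Fib d) := fun x z a b => wVH d Lc (j + 1) * E2 d Lc (j + 1) x z a b with hH
  have hw : wVH d Lc (j + 1) ≠ 0 := wVH_ne_zero (j + 1)
  obtain ⟨CM, δM, hδM, hMd⟩ := spr_bhKStep (d := d) (Lc := Lc) (j + 1)
  have hkkt := mm_mixed_sandwich_eq_neg (N := Lc) (A := A) (M := bhKStep d Lc (j + 1)) (G := G) (H := H)
    (decays_KInvStep (Lc := Lc) (d := d) (j + 1)) (decays_Gsym (d := d) Lc (j + 1))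
    ⟨CM, fun x z a b => bdd_of_decays hMd hδM.le x z a b⟩ (fun x z ν ν' => rfl)
    (fun x z κ l => by rw [hH, bhKStep_succ_inl_inl]) (fun x z κ ν => by simp only [hH, E2_inr_col, mul_zero])
    (fun x z ν l => by simp only [hH]; exact mul_eq_zero_of_right _ rfl) (fun x z ν ν' => by simp only [hH, E2_inr_col, mul_zero])
    (fun x v m l => comp_KInvStep_bhKStep_inr_inl (d := d) (Lc := Lc) j x v m l)
    (fun u z ν m' hu => comp_bhKStep_Gsym_inr_inr (d := d) (Lc := Lc) (j + 1) u z ν m' hu)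
    (fun x u m ν hu => KInvStep_inr_inr_of_col_off (d := d) (Lc := Lc) (j + 1) x u m ν hu)
    ((Lc : ℤ) • w) ((Lc : ℤ) • y) ρ' μ
  -- comp (comp A H) G = wVH • comp (comp A E2) G, entrywise
  have hlin : comp (comp A H) G ((Lc : ℤ) • w) ((Lc : ℤ) • y) (Sum.inr ρ') (Sum.inr μ)
      = wVH d Lc (j + 1) * comp (comp A (E2 d Lc (j + 1))) G ((Lc : ℤ) • w) ((Lc : ℤ) • y) (Sum.inr ρ') (Sum.inr μ) := by
    have hAH : comp A H = fun x z a b => wVH d Lc (j + 1) * comp A (E2 d Lc (j + 1)) x z a b := by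
      funext x z a b
      simp only [ExpKernelCalculus.comp, hH, ← tsum_mul_left, Finset.mul_sum]
      exact tsum_congr fun u => Finset.sum_congr rfl fun f _ => by ring
    rw [hAH]
    rw [show comp (fun x z a b => wVH d Lc (j + 1) * comp A (E2 d Lc (j + 1)) x z a b) G ((Lc : ℤ) • w) ((Lc : ℤ) • y) (Sum.inr ρ') (Sum.inr μ)
        = ∑' v, ∑ g : Fib d, (wVH d Lc (j + 1) * comp A (E2 d Lc (j + 1)) ((Lc : ℤ) • w) v (Sum.inr ρ') g) * G v ((Lc : ℤ) • y) g (Sum.inr μ)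
        from rfl,
      show comp (comp A (E2 d Lc (j + 1))) G ((Lc : ℤ) • w) ((Lc : ℤ) • y) (Sum.inr ρ') (Sum.inr μ)
        = ∑' v, ∑ g : Fib d, comp A (E2 d Lc (j + 1)) ((Lc : ℤ) • w) v (Sum.inr ρ') g * G v ((Lc : ℤ) • y) g (Sum.inr μ) from rfl,
      ← tsum_mul_left]
    exact tsum_congr fun v => by rw [Finset.mul_sum]; exact Finset.sum_congr rfl fun g _ => by ring
  rw [colM_Gsym (d := d) (Lc := Lc) (j + 1)]
  simp only [colM]
  rw [hlin] at hkkt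
  field_simp
  linarith

/-- [folklore] **THE MULTIPLIER COLUMN OF THE MIXED SANDWICH AT THE LITERAL's RESOLVENTS, LEVEL `0`**: with `H₀` the field block of `bhK Lc`,
`colM (KInvStep Lc 0 ∘ H₀ ∘ Gsym Lc 0) Lc μ y ρ′ w = −colM (Gsym Lc 0) Lc μ y ρ′ w`. -/
theorem colM_mixed_sandwich_zero_sym (μ : Fin (d + 1)) (y : Fin (d + 1) → ℤ) (ρ' : Fin (d + 1)) (w : Fin (d + 1) → ℤ) :
    colM (comp (comp (KInvStep (d := d) Lc 0)
        (fun x z a b => match a, b with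
          | Sum.inl κ, Sum.inl l => bhK (d := d) Lc x z (Sum.inl κ) (Sum.inl l)
          | _, _ => 0))
        (Gsym (d := d) Lc 0)) Lc μ y ρ' w
      = -colM (Gsym (d := d) Lc 0) Lc μ y ρ' w := by
  set H₀ : MKer (d + 1) (Fib d) := fun x z a b => match a, b with
    | Sum.inl κ, Sum.inl l => bhK (d := d) Lc x z (Sum.inl κ) (Sum.inl l)
    | _, _ => 0 with hH
  obtain ⟨CM, δM, hδM, hMd⟩ := spr_bhKStep (d := d) (Lc := Lc) 0
  have hHff : ∀ x z (κ l : Fin (d + 1)), H₀ x z (Sum.inl κ) (Sum.inl l) = bhKStep d Lc 0 x z (Sum.inl κ) (Sum.inl l) :=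
    fun x z κ l => by rw [bhKStep_zero]
  have hHfm : ∀ x z (κ ν : Fin (d + 1)), H₀ x z (Sum.inl κ) (Sum.inr ν) = 0 := fun x z κ ν => rfl
  have hHmf : ∀ x z (ν l : Fin (d + 1)), H₀ x z (Sum.inr ν) (Sum.inl l) = 0 := fun x z ν l => rfl
  have hHmm : ∀ x z (ν ν' : Fin (d + 1)), H₀ x z (Sum.inr ν) (Sum.inr ν') = 0 := fun x z ν ν' => rfl
  have hMmm : ∀ x z (ν ν' : Fin (d + 1)), bhKStep d Lc 0 x z (Sum.inr ν) (Sum.inr ν') = 0 := fun x z ν ν' => by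
    rw [bhKStep_zero, bhK_inr_inr]
  have hkkt := mm_mixed_sandwich_eq_neg (N := Lc) (A := KInvStep (d := d) Lc 0) (M := bhKStep d Lc 0) (G := Gsym (d := d) Lc 0) (H := H₀)
    (decays_KInvStep (Lc := Lc) (d := d) 0) (decays_Gsym (d := d) Lc 0) ⟨CM, fun x z a b => bdd_of_decays hMd hδM.le x z a b⟩ hMmm
    hHff hHfm hHmf hHmm (fun x v m l => comp_KInvStep_bhKStep_zero_inr_inl (d := d) (Lc := Lc) x v m l)
    (fun u z ν m' hu => comp_bhKStep_Gsym_inr_inr (d := d) (Lc := Lc) 0 u z ν m' hu)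
    (fun x u m ν hu => KInvStep_inr_inr_of_col_off (d := d) (Lc := Lc) 0 x u m ν hu)
    ((Lc : ℤ) • w) ((Lc : ℤ) • y) ρ' μ
  rw [colM_Gsym (d := d) (Lc := Lc) 0]
  simp only [colM]
  exact hkkt

end Literal

end Summit.QuantumFields.BalabanUV.Beta.LagrangeFoldMixed

end
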